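import Mathlib
import HarnessLib
import Literature.Analysis.FluidPDE.SuitableWeak
import Literature.Analysis.FluidPDE.SelfSimilar
import Literature.Analysis.FluidPDE.LocalTypeI
import Summits.NavierStokesRegularity.NavierStokesRegularity.Theorems.RellichScarApexLocalisationRdLocalApex
import Summits.NavierStokesRegularity.NavierStokesRegularity.Theorems.RellichScarApexLocalisationRdTower
import Summits.NavierStokesRegularity.NavierStokesRegularity.Theses.RellichScar

/-!
# Russian-doll STRUCTURE of a counterexample to `RellichScar.ApexLocalisation` (line russian-doll-multiplicity, lead c5)

A by-product of the line for planners / the standing disprover, packaged against the crux BY NAME: if the crux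
`Summit.NavierStokesRegularity.NavierStokesRegularity.Theses.RellichScar.ApexLocalisation`
(stmt-NavierStokesRegularity-11719) FAILS, then no apex-class singular profile exists at all, so the landed tower theorem
`stub_rdTower` (with its local-apex input `stub_rdLocalApex`) applies unconditionally: EVERY continuous rate-Type-I suitable
weak slab profile with `𝐈 < ⊤` that is singular at the origin carries, for every `m` and inside every cylinder `Q_δ(0,0)`, `m`
blowing-up satellites `‖w(τᵢ,yᵢ)‖ > 1/(ερ)`, `−ερ² < τᵢ < 0`, pairwise and from the origin `3ρ`-separated, at ONE scale `ρ < δ`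
(`stub_rdTowersOfNotApexLocalisation`).  Equivalently (positive form, `rd_apex_or_towers`): for every such profile, either an
apex singular profile exists or the profile has towers of every height at arbitrarily small scales — a finite-configuration test
that any constructed / numerical / discretely self-similar Type-I candidate can be checked against.

## References

* D. Albritton, T. Barker, J. Math. Fluid Mech. 21 (2019) = arXiv:1811.00502, Lemma 2.2, Prop. 2.3, §3. [AlbrittonBarker2019]
-/

noncomputable section

set_option linter.dupNamespace false

namespace Summit.NavierStokesRegularity.NavierStokesRegularity.Theorems.RellichScarApexLocalisation

open MeasureTheory Set Function Metric Filter Topology TopologicalSpace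
open scoped ENNReal NNReal
open Literature.Analysis Literature.Analysis.FluidPDE
open Summit.NavierStokesRegularity.NavierStokesRegularity.Theses

local notation "E³" => EuclideanSpace ℝ (Fin 3)

/-- The open backward slab `(-∞, 0) × ℝ³` (time first). -/
local notation "𝕊" => Literature.Analysis.FluidPDE.slab (EuclideanSpace ℝ (Fin 3)) (Set.Iio (0 : ℝ)) isOpen_Iio

/-- **Apex or towers** (positive form of the doll structure theorem): for every continuous rate-Type-I suitable weak
slab profile with `𝐈 ≤ I < ⊤` singular at the origin, EITHER some apex-class singular profile exists, OR the profile carries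
`m` blowing-up, `3ρ`-separated satellites at one scale `ρ < δ` inside `Q_δ(0,0)`, for every `m, ε, δ`
(`stub_rdTower` fed with `stub_rdLocalApex`). [cite: AlbrittonBarker2019, Lemma 2.2, Prop. 2.3 and §3] -/
theorem rd_apex_or_towers (m : ℕ) (C : ℝ) (I : ℝ≥0∞) (hI : I < ⊤)
    (w : ℝ → E³ → E³) (q : ℝ → E³ → ℝ) (H : ℝ → E³ → E³ →L[ℝ] E³)
    (hsw : IsSuitableWeakSolutionOn 𝕊 1 0 w q) (hwg : HasWeakSpatialGradientOn 𝕊 w H)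
    (hIle : typeIBound (Iio (0 : ℝ) ×ˢ univ) w q H ≤ I) (hC : HasTypeITimeDecay C w)
    (hcont : ContinuousOn (uncurry w) (Iio (0 : ℝ) ×ˢ univ)) (hsing : IsBackwardSingularPoint w 0)
    (ε δ : ℝ) (hε : 0 < ε) (hδ : 0 < δ) :
    (∃ (C' : ℝ) (u : ℝ → E³ → E³) (p : ℝ → E³ → ℝ) (G : ℝ → E³ → E³ →L[ℝ] E³),
        IsSuitableWeakSolutionOn 𝕊 1 0 u p ∧ HasWeakSpatialGradientOn 𝕊 u G ∧
        typeIBound (Iio (0 : ℝ) ×ˢ univ) u p G < ⊤ ∧ HasTypeIDecay C' u ∧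
        IsBackwardSingularPoint u 0) ∨
    ∃ ρ : ℝ, 0 < ρ ∧ ρ < δ ∧ ∃ (τ : Fin m → ℝ) (y : Fin m → E³),
      (∀ i, -(ε * ρ ^ 2) < τ i ∧ τ i < 0 ∧ ‖y i‖ < δ ∧ 3 * ρ < ‖y i‖ ∧
        1 / (ε * ρ) < ‖w (τ i) (y i)‖) ∧
      (∀ i j, i ≠ j → 3 * ρ < ‖y i - y j‖) := by
  by_cases hapex : ∃ (C' : ℝ) (u : ℝ → E³ → E³) (p : ℝ → E³ → ℝ) (G : ℝ → E³ → E³ →L[ℝ] E³),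
      IsSuitableWeakSolutionOn 𝕊 1 0 u p ∧ HasWeakSpatialGradientOn 𝕊 u G ∧
      typeIBound (Iio (0 : ℝ) ×ˢ univ) u p G < ⊤ ∧ HasTypeIDecay C' u ∧ IsBackwardSingularPoint u 0
  · exact Or.inl hapex
  · exact Or.inr (stub_rdTower hapex stub_rdLocalApex m C I hI w q H hsw hwg hIle hC hcont hsing ε δ hε hδ)

/-- **Towers in every rate profile if the crux fails** (registered by-product stub
`stub_rdTowersOfNotApexLocalisation` of crux stmt-NavierStokesRegularity-11719): if `RellichScar.ApexLocalisation` is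
false then no apex-class singular profile exists (the crux's conclusion fails for the witnessing constant), hence, by
`stub_rdTower` and `stub_rdLocalApex`, every continuous rate-Type-I suitable weak slab profile with `𝐈 < ⊤` singular at the
origin has Russian-doll towers of every height `m` at arbitrarily small scales: `m` satellites `‖w(τᵢ,yᵢ)‖ > 1/(ερ)`,
`−ερ² < τᵢ < 0`, `‖yᵢ‖ < δ`, pairwise and from the origin `3ρ`-separated, `0 < ρ < δ`.
[cite: AlbrittonBarker2019, Lemma 2.2, Prop. 2.3 and §3] -/
theorem stub_rdTowersOfNotApexLocalisation :
    ¬ RellichScar.ApexLocalisation →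
    ∀ (m : ℕ) (C : ℝ) (I : ℝ≥0∞), I < ⊤ →
      ∀ (w : ℝ → E³ → E³) (q : ℝ → E³ → ℝ) (H : ℝ → E³ → E³ →L[ℝ] E³),
        IsSuitableWeakSolutionOn 𝕊 1 0 w q → HasWeakSpatialGradientOn 𝕊 w H →
        typeIBound (Iio (0 : ℝ) ×ˢ univ) w q H ≤ I → HasTypeITimeDecay C w →
        ContinuousOn (uncurry w) (Iio (0 : ℝ) ×ˢ univ) → IsBackwardSingularPoint w 0 →
        ∀ (ε δ : ℝ), 0 < ε → 0 < δ →
        ∃ ρ : ℝ, 0 < ρ ∧ ρ < δ ∧ ∃ (τ : Fin m → ℝ) (y : Fin m → E³),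
          (∀ i, -(ε * ρ ^ 2) < τ i ∧ τ i < 0 ∧ ‖y i‖ < δ ∧ 3 * ρ < ‖y i‖ ∧
            1 / (ε * ρ) < ‖w (τ i) (y i)‖) ∧
          (∀ i j, i ≠ j → 3 * ρ < ‖y i - y j‖) := by
  intro hnot
  have hapex : ¬ ∃ (C' : ℝ) (u : ℝ → E³ → E³) (p : ℝ → E³ → ℝ) (G : ℝ → E³ → E³ →L[ℝ] E³),
      IsSuitableWeakSolutionOn 𝕊 1 0 u p ∧ HasWeakSpatialGradientOn 𝕊 u G ∧
      typeIBound (Iio (0 : ℝ) ×ˢ univ) u p G < ⊤ ∧ HasTypeIDecay C' u ∧ IsBackwardSingularPoint u 0 := by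
    rintro ⟨C', u, p, G, hsw, hwg, hI, hdec, hsing⟩
    exact hnot fun C _ => ⟨C', u, p, G, hsw, hwg, hI, hdec, hsing⟩
  exact stub_rdTower hapex stub_rdLocalApex

end Summit.NavierStokesRegularity.NavierStokesRegularity.Theorems.RellichScarApexLocalisation

end
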